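import Literature.NumberTheory.Automorphic.AsaiSignContinuation
import HarnessLib

/-!
# Asai poles and Asai signs in CONTINUATION form

Topic `NumberTheory/Automorphic`; namespace `Literature.NumberTheory.Automorphic`.  Companion of
`AsaiSign` (`HasAsaiPole`, `HasAsaiSign`: the RAW partial-Euler-product rendering, whose defect is
documented in `AsaiSignContinuation` and in `Mok2014_partialAsaiL_pole_dichotomy`'s docstring) and of
`AsaiSignContinuation` (the corrected statement of Mok's dichotomy as the hypothesis `h` of the proved
reduction `Mok2014_partialAsaiL_pole_dichotomy_of_continuation`).

## What is here

* `AutomorphicRepData.HasAsaiPoleCont c η` / `HasAsaiHolAtOneCont c η` / `HasAsaiSignCont c κ` — the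
  per-representation predicates of the corrected statement: for every Asai datum `(S, A)` (`IsAsaiDatum`)
  the partial Asai Euler product of sign `η` is multipliable on some right half-plane `Re s > σ₀`
  (`σ₀ ≥ 1`) and `(s - 1) L^S(s, Π, As^η)` (resp. `L^S(s, Π, As^η)`) extends to a function holomorphic on
  `{1/2 < Re s}` which does not vanish at `s = 1` — i.e. the meromorphically continued partial Asai
  `L`-function has a simple pole (resp. is holomorphic and non-zero) at `s = 1`.  These are the
  sources' notions (Mok, §2.5; Grbac–Shahidi 2015, §2.A: the Asai `L`-function is the analytic
  continuation of a product absolutely convergent for `Re s` large), rendered datum by datum exactly as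
  in the hypothesis `h` of `Mok2014_partialAsaiL_pole_dichotomy_of_continuation`.
* `Mok2014_partialAsaiL_continuation_pole_dichotomy` — the corrected named fact (Mok, §2.5 and
  Thm. 2.5.4 (a); Grbac–Shahidi 2015, Thm. 4.3 (2)), VERBATIM the hypothesis `h` of the accepted
  reduction theorem (the `defact` unit that proved the reduction could not mint the fact, D-0026; its
  docstring asks for exactly this cite item).
* Proved: `exists_hasAsaiPoleCont` (existence of the continuation-form sign under the fact),
  `HasAsaiPoleCont.not_hasAsaiHolAtOneCont` (a continued simple pole excludes holomorphy-at-one for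
  the same sign and datum family, `continuation_pole_not_holomorphic`), `hasAsaiPoleCont_unique`
  (at most one sign has the continued pole, given an Asai datum), and the bridge to the raw rendering:
  `HasAsaiPoleCont.hasAsaiPole_of_differentiableOn` — a continued pole PLUS holomorphy of the raw
  product on `{1 < Re s}` (the unpublished, Ramanujan-strength ingredient) gives the raw `HasAsaiPole`
  (`tendsto_nhdsWithin_one_lt_re_of_continuation`).

Consumers that today take the raw `HasAsaiSign` as a HYPOTHESIS (e.g. the Fakhruddin–Pilloni facts of
`WeaklyRegularGaloisRep`) are unaffected; consumers that must PRODUCE an Asai sign (the descent lines of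
the crux `QuadraticWindow.HostInducedRep`) can now state their obligations in the continuation form.

## References
* C. P. Mok, *Endoscopic classification of representations of quasi-split unitary groups*, Mem. AMS 235
  (2015) no. 1108, §2.5 (paragraph before Thm. 2.5.4) and Thm. 2.5.4 (a). [Mok2014]
* N. Grbac, F. Shahidi, *Endoscopic transfer for unitary groups and holomorphy of Asai L-functions*,
  Pacific J. Math. 276 (2015), §2.A and Thm. 4.3. [GrbacShahidi2015]
* Y. Z. Flicker, *Twisted tensors and Euler products*, Bull. SMF 116 (1988), Theorem p. 297. [Flicker1988]
-/

noncomputable section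

open scoped Topology Classical
open NumberField IsDedekindDomain Filter

namespace Literature.NumberTheory.Automorphic

variable {F E : Type} [Field F] [NumberField F] [Field E] [NumberField E] [Algebra F E]
  {N : ℕ} {hcpt : isCompact_glFiniteIntegralLevel N E}

namespace AutomorphicRepData

/-- **The continued partial Asai `L`-function `L^S(s, Π, As^η)` has a simple pole at `s = 1`**
(continuation form): for every Asai datum `(S, A)` of `π` there is `σ₀ ≥ 1` such that the partial
Asai Euler product of sign `η` is multipliable for `Re s > σ₀` and `(s - 1) L^S(s, Π, As^η)` extends
from `Re s > σ₀` to a function `G` holomorphic on `{1/2 < Re s}` with `G(1) ≠ 0`.  This is clause (ii)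
of the corrected statement of Mok's dichotomy (hypothesis `h` of
`Mok2014_partialAsaiL_pole_dichotomy_of_continuation`) for one representation.
[cite: Mok2014, §2.5 and Thm. 2.5.4 (a)] [cite: GrbacShahidi2015, §2.A and Thm. 4.3 (2)] -/
def HasAsaiPoleCont (π : AutomorphicRepData (AutomorphyDatum.gl N E hcpt)) (c : E ≃ₐ[F] E) (η : ℤˣ) :
    Prop :=
  ∀ ⦃S : Set (HeightOneSpectrum (𝓞 F))⦄ ⦃A : SatakeFamily E⦄, π.IsAsaiDatum c S A →
    ∃ σ₀ : ℝ, 1 ≤ σ₀ ∧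
      (∀ s : ℂ, σ₀ < s.re →
        Multipliable fun v : {v : HeightOneSpectrum (𝓞 F) // v ∉ S} =>
          ((asaiLocalPolynomial c A η (placeAbove E v.1)).eval ((v.1.residueCard : ℂ) ^ (-s)))⁻¹) ∧
      ∃ G : ℂ → ℂ, DifferentiableOn ℂ G {s : ℂ | 1 / 2 < s.re} ∧
        (∀ s : ℂ, σ₀ < s.re → G s = (s - 1) * partialAsaiL S c A η s) ∧ G 1 ≠ 0

/-- **The continued partial Asai `L`-function `L^S(s, Π, As^η)` is holomorphic and non-zero at `s = 1`**
(continuation form): for every Asai datum there is `σ₀ ≥ 1` with the product multipliable for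
`Re s > σ₀` and a function `H` holomorphic on `{1/2 < Re s}`, equal to `L^S(s, Π, As^η)` for `Re s > σ₀`,
with `H(1) ≠ 0`.  Clause (iii) of the corrected statement, for one representation and one sign.
[cite: Mok2014, §2.5 and Thm. 2.5.4 (a)] [cite: GrbacShahidi2015, §2.A and Thm. 4.3 (2)] -/
def HasAsaiHolAtOneCont (π : AutomorphicRepData (AutomorphyDatum.gl N E hcpt)) (c : E ≃ₐ[F] E)
    (η : ℤˣ) : Prop :=
  ∀ ⦃S : Set (HeightOneSpectrum (𝓞 F))⦄ ⦃A : SatakeFamily E⦄, π.IsAsaiDatum c S A →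
    ∃ σ₀ : ℝ, 1 ≤ σ₀ ∧
      (∀ s : ℂ, σ₀ < s.re →
        Multipliable fun v : {v : HeightOneSpectrum (𝓞 F) // v ∉ S} =>
          ((asaiLocalPolynomial c A η (placeAbove E v.1)).eval ((v.1.residueCard : ℂ) ^ (-s)))⁻¹) ∧
      ∃ H : ℂ → ℂ, DifferentiableOn ℂ H {s : ℂ | 1 / 2 < s.re} ∧
        (∀ s : ℂ, σ₀ < s.re → H s = partialAsaiL S c A η s) ∧ H 1 ≠ 0

/-- **Asai sign `κ` in continuation form**: `L^S(s, Π, As^η)` has the continued simple pole at `s = 1`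
for `η = (-1)^{N-1} κ` (spelled `(-1) ^ (N + 1) * κ`), cf. `HasAsaiSign` (raw rendering) and Mok,
Thm. 2.5.4 (a): `κ = +1` iff `Π` is a standard base change from `U_{E/F}(N)`, `κ = -1` iff a twisted one.
[cite: Mok2014, Thm. 2.5.4 (a) and the following Remark] -/
def HasAsaiSignCont (π : AutomorphicRepData (AutomorphyDatum.gl N E hcpt)) (c : E ≃ₐ[F] E) (κ : ℤˣ) :
    Prop :=
  π.HasAsaiPoleCont c ((-1) ^ (N + 1) * κ)

/-- Unfolding `HasAsaiSignCont`. [folklore] -/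
theorem hasAsaiSignCont_iff (π : AutomorphicRepData (AutomorphyDatum.gl N E hcpt)) (c : E ≃ₐ[F] E)
    (κ : ℤˣ) : π.HasAsaiSignCont c κ ↔ π.HasAsaiPoleCont c ((-1) ^ (N + 1) * κ) :=
  Iff.rfl

/-- `HasAsaiPoleCont` in terms of `HasAsaiSignCont`: `η = (-1)^{N-1} κ` iff `κ = (-1)^{N-1} η`. [folklore] -/
theorem hasAsaiPoleCont_iff_hasAsaiSignCont (π : AutomorphicRepData (AutomorphyDatum.gl N E hcpt))
    (c : E ≃ₐ[F] E) (η : ℤˣ) : π.HasAsaiPoleCont c η ↔ π.HasAsaiSignCont c ((-1) ^ (N + 1) * η) := by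
  rw [hasAsaiSignCont_iff, ← mul_assoc, Int.units_mul_self, one_mul]

/-- **A continued simple pole at `s = 1` excludes holomorphy (and non-vanishing) at `s = 1` for the
same sign**, given one Asai datum (`continuation_pole_not_holomorphic`). [folklore] -/
theorem HasAsaiPoleCont.not_hasAsaiHolAtOneCont {π : AutomorphicRepData (AutomorphyDatum.gl N E hcpt)}
    {c : E ≃ₐ[F] E} {η : ℤˣ} (hp : π.HasAsaiPoleCont c η) {S : Set (HeightOneSpectrum (𝓞 F))}
    {A : SatakeFamily E} (hSA : π.IsAsaiDatum c S A) : ¬ π.HasAsaiHolAtOneCont c η := by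
  intro hh
  obtain ⟨σ₀, hσ₀, -, G, hG, hGL, hG1⟩ := hp hSA
  obtain ⟨σ₁, -, -, H, hH, hHL, -⟩ := hh hSA
  exact continuation_pole_not_holomorphic hσ₀ hG hGL hG1 hH hHL

/-- **Bridge to the raw rendering.**  A continued simple pole of sign `η` PLUS the holomorphy of the
raw partial Asai product of sign `η` on the open half-plane `{1 < Re s}` (for the datum at hand) gives
the raw `Tendsto ((s - 1) L^S) → G(1) ≠ 0` of `HasAsaiPole` (identity theorem + continuity of the
continuation at `1`, `tendsto_nhdsWithin_one_lt_re_of_continuation`).  The holomorphy hypothesis is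
the unpublished ingredient isolated in `AsaiSignContinuation` (a consequence of the Ramanujan
conjecture for `Π`; not needed as a hypothesis by any consumer stated in continuation form). [folklore] -/
theorem HasAsaiPoleCont.hasAsaiPole_of_differentiableOn
    {π : AutomorphicRepData (AutomorphyDatum.gl N E hcpt)} {c : E ≃ₐ[F] E} {η : ℤˣ}
    (hp : π.HasAsaiPoleCont c η)
    (hhol : ∀ ⦃S : Set (HeightOneSpectrum (𝓞 F))⦄ ⦃A : SatakeFamily E⦄, π.IsAsaiDatum c S A →
      DifferentiableOn ℂ (partialAsaiL S c A η) {s : ℂ | 1 < s.re}) :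
    π.HasAsaiPole c η := by
  intro S A hSA
  obtain ⟨σ₀, hσ₀, -, G, hG, hGL, hG1⟩ := hp hSA
  refine ⟨G 1, hG1, ?_⟩
  have hf : DifferentiableOn ℂ (fun s => (s - 1) * partialAsaiL S c A η s) {s : ℂ | 1 < s.re} :=
    (differentiableOn_id.sub_const 1).mul (hhol hSA)
  exact tendsto_nhdsWithin_one_lt_re_of_continuation hσ₀ hG hf hGL

end AutomorphicRepData

/-! ### The corrected named fact (Mok's dichotomy for the continued partial Asai `L`-functions) -/

/-- **Mok's Asai-pole dichotomy, continuation form** (the corrected statement of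
`Mok2014_partialAsaiL_pole_dichotomy`; VERBATIM the hypothesis `h` of the accepted reduction
`Mok2014_partialAsaiL_pole_dichotomy_of_continuation` of `AsaiSignContinuation`, whose docstring quotes
the sources and asks for this cite item).  Printed (Mok, §2.5, before Thm. 2.5.4): for a conjugate
self-dual unitary cuspidal `φ^N` on `GL_N(𝔸_E)`, "`L(s, φ^N × (φ^N)^c) = L(s, φ^N × (φ^N)^∨)`, hence has
a simple pole at `s = 1` by [JPSS]. Furthermore by Shahidi's theorem [S], both functions
`L(s, φ^N, As^±)` are non-zero at `s = 1`. Hence we see that exactly one of the functions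
`L(s, φ^N, As^±)` has a pole at `s = 1`, which is a simple pole"; Thm. 2.5.4 (a): "the Asai `L`-function
`L(s, φ^N, As^η)` has a pole at `s = 1`, where `η = (-1)^{N-1} κ`"; Grbac–Shahidi 2015, Thm. 4.3 (2): for
Galois self-dual cuspidal `σ`, "(a) `L(s, σ, r_A)` is entire, except for possible simple poles at `s = 0`
and `s = 1`, and nonzero for `Re(s) ≥ 1` …; (b) exactly one of the `L`-functions `L(s, σ, r_A)` and
`L(s, σ ⊗ δ̂, r_A)` has simple poles at `s = 0` and `s = 1`, while the other is holomorphic at those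
points", the Asai `L`-functions being the analytic continuations of Euler products absolutely convergent
"in some right half-plane `Re(s) > C`" (§2.A; Flicker 1988, Theorem p. 297).
Rendering: `E/F` quadratic (`finrank F E = 2`), non-trivial automorphism `c`; `Π` a cuspidal
automorphic representation datum of `GL_N(𝔸_E)`, `N ≥ 1`, conjugate self-dual a.e. on Satake parameters
(`IsConjSelfDualAE`); conclusion: a sign `η`, depending on `Π` only, such that for EVERY Asai datum
`(S, A)` (`IsAsaiDatum`) there is `σ₀ ≥ 1` with (i) both partial Asai Euler products multipliable for
`Re s > σ₀`; (ii) `(s - 1) L^S(s, Π, As^η)` extends to `G` holomorphic on `{1/2 < Re s}` with `G(1) ≠ 0`;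
(iii) `L^S(s, Π, As^{-η})` extends to `H` holomorphic on `{1/2 < Re s}` with `H(1) ≠ 0`.  (Partial versus
complete `L`-functions: finitely many reciprocal local factors, entire; which sign carries the pole is
read at the partial level from `L^{S_E}(s, Π × Π^c) = L^S(As⁺) L^S(As⁻)`,
`partialPairL_smul_eq_partialAsaiL_mul`, and the simple pole of the Rankin–Selberg function; see the
docstrings in `AsaiSign` / `AsaiSignContinuation`.)  Like Mok's and Grbac–Shahidi's theorems it is
conditional on the stabilisation of the twisted trace formula.  Named fact (D-0014), not proved here;
by `Mok2014_partialAsaiL_pole_dichotomy_of_continuation` it implies the deprecated raw rendering once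
the raw products are holomorphic on `{1 < Re s}`.
[cite: Mok2014, §2.5 (paragraph before Thm. 2.5.4) and Thm. 2.5.4 (a)]
[cite: GrbacShahidi2015, §2.A and Thm. 4.3 (2)] [cite: Flicker1988, Theorem p. 297] -/
def Mok2014_partialAsaiL_continuation_pole_dichotomy : Prop :=
  ∀ (F E : Type) [Field F] [NumberField F] [Field E] [NumberField E] [Algebra F E]
    (c : E ≃ₐ[F] E), Module.finrank F E = 2 → c ≠ 1 →
    ∀ (N : ℕ) (hcpt : isCompact_glFiniteIntegralLevel N E)
      (π : CuspidalAutomorphicRepData N E hcpt), 0 < N → π.1.IsConjSelfDualAE c →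
      ∃ η : ℤˣ, ∀ (S : Set (HeightOneSpectrum (𝓞 F))) (A : SatakeFamily E),
        π.1.IsAsaiDatum c S A →
          ∃ σ₀ : ℝ, 1 ≤ σ₀ ∧
            (∀ (θ : ℤˣ) (s : ℂ), σ₀ < s.re →
              Multipliable fun v : {v : HeightOneSpectrum (𝓞 F) // v ∉ S} =>
                ((asaiLocalPolynomial c A θ (placeAbove E v.1)).eval
                  ((v.1.residueCard : ℂ) ^ (-s)))⁻¹) ∧
            (∃ G : ℂ → ℂ, DifferentiableOn ℂ G {s : ℂ | 1 / 2 < s.re} ∧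
              (∀ s : ℂ, σ₀ < s.re → G s = (s - 1) * partialAsaiL S c A η s) ∧ G 1 ≠ 0) ∧
            (∃ H : ℂ → ℂ, DifferentiableOn ℂ H {s : ℂ | 1 / 2 < s.re} ∧
              (∀ s : ℂ, σ₀ < s.re → H s = partialAsaiL S c A (-η) s) ∧ H 1 ≠ 0)

section Consequences

variable {c : E ≃ₐ[F] E}

/-- **Existence of the continuation-form Asai sign** (from the corrected dichotomy): a conjugate
self-dual cuspidal `Π`, `N ≥ 1`, has a sign `η` with `HasAsaiPoleCont c η` and `HasAsaiHolAtOneCont c (-η)`.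
[cite: Mok2014, Thm. 2.5.4 (a)] -/
theorem CuspidalAutomorphicRepData.exists_hasAsaiPoleCont
    (hMok : Mok2014_partialAsaiL_continuation_pole_dichotomy) (h2 : Module.finrank F E = 2) (hc : c ≠ 1)
    (hN : 0 < N) (π : CuspidalAutomorphicRepData N E hcpt) (hπ : π.1.IsConjSelfDualAE c) :
    ∃ η : ℤˣ, π.1.HasAsaiPoleCont c η ∧ π.1.HasAsaiHolAtOneCont c (-η) := by
  obtain ⟨η, hη⟩ := hMok F E c h2 hc N hcpt π hN hπ
  refine ⟨η, fun S A hSA => ?_, fun S A hSA => ?_⟩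
  · obtain ⟨σ₀, hσ₀, hmul, hG, -⟩ := hη S A hSA
    exact ⟨σ₀, hσ₀, fun s hs => hmul η s hs, hG⟩
  · obtain ⟨σ₀, hσ₀, hmul, -, hH⟩ := hη S A hSA
    exact ⟨σ₀, hσ₀, fun s hs => hmul (-η) s hs, hH⟩

/-- **Existence of the continuation-form Asai SIGN `κ`.** [cite: Mok2014, Thm. 2.5.4 (a)] -/
theorem CuspidalAutomorphicRepData.exists_hasAsaiSignCont
    (hMok : Mok2014_partialAsaiL_continuation_pole_dichotomy) (h2 : Module.finrank F E = 2) (hc : c ≠ 1)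
    (hN : 0 < N) (π : CuspidalAutomorphicRepData N E hcpt) (hπ : π.1.IsConjSelfDualAE c) :
    ∃ κ : ℤˣ, π.1.HasAsaiSignCont c κ := by
  obtain ⟨η, hη, -⟩ := π.exists_hasAsaiPoleCont hMok h2 hc hN hπ
  exact ⟨(-1) ^ (N + 1) * η, (π.1.hasAsaiPoleCont_iff_hasAsaiSignCont c η).mp hη⟩

/-- **Uniqueness of the continued pole sign**: given one Asai datum, at most one sign `η` has
`HasAsaiPoleCont c η` (the other sign is holomorphic and non-zero at `1` by the dichotomy, and a
continued simple pole excludes that). [cite: Mok2014, §2.5 before Thm. 2.5.4] -/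
theorem CuspidalAutomorphicRepData.hasAsaiPoleCont_unique
    (hMok : Mok2014_partialAsaiL_continuation_pole_dichotomy) (h2 : Module.finrank F E = 2) (hc : c ≠ 1)
    (hN : 0 < N) (π : CuspidalAutomorphicRepData N E hcpt) (hπ : π.1.IsConjSelfDualAE c)
    {S : Set (HeightOneSpectrum (𝓞 F))} {A : SatakeFamily E} (hSA : π.1.IsAsaiDatum c S A)
    {η η' : ℤˣ} (hη : π.1.HasAsaiPoleCont c η) (hη' : π.1.HasAsaiPoleCont c η') : η = η' := by
  obtain ⟨η₀, -, hhol⟩ := π.exists_hasAsaiPoleCont hMok h2 hc hN hπ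
  -- every sign with a continued pole equals `η₀`: the opposite sign `-η₀` is holomorphic at `1`
  have key : ∀ θ : ℤˣ, π.1.HasAsaiPoleCont c θ → θ = η₀ := by
    intro θ hθ
    rcases Int.units_eq_one_or θ with rfl | rfl <;> rcases Int.units_eq_one_or η₀ with h₀ | h₀
    · exact h₀.symm
    · exact absurd (h₀ ▸ hhol : π.1.HasAsaiHolAtOneCont c (-(-1))) (by
        rw [neg_neg]; exact hθ.not_hasAsaiHolAtOneCont hSA)
    · exact absurd (h₀ ▸ hhol : π.1.HasAsaiHolAtOneCont c (-1)) (hθ.not_hasAsaiHolAtOneCont hSA)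
    · exact h₀.symm
  rw [key η hη, key η' hη']

end Consequences

/-! ### The Galois-self-dual stratum of `GrbacShahidi2015_partialAsaiL_at_one`

The named fact `GrbacShahidi2015_partialAsaiL_at_one` of `AsaiSignContinuation` (Grbac–Shahidi 2015,
Thm. 4.3 (1) and (2)(a)–(b) at `s = 1`, for the continued partial Asai `L`-functions of every unitary
cuspidal `Π` and every sign) asks, datum by datum and sign by sign, for `σ₀ ≥ 1`, multipliability of the
partial Asai product on `Re s > σ₀`, and a function `G` holomorphic on `{1 < Re s} ∪ B(1, δ)` with
`G = (s - 1)^k L^S(s, Π, As^η)` on `Re s > σ₀`, `k ≤ 1`, `G(1) ≠ 0`.  For a **conjugate self-dual** `Π`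
this is exactly what Mok's dichotomy in continuation form provides (Grbac–Shahidi, Thm. 4.3 (2) is Mok's
dichotomy: "exactly one of the `L`-functions … has simple poles at `s = 0` and `s = 1`, while the other
is holomorphic at those points", pp. 186 and 204): the pole sign gives `k = 1`, the other sign `k = 0`,
with `δ = 1/2` since `{1 < Re s} ∪ B(1, 1/2) ⊆ {1/2 < Re s}`.  The non-self-dual stratum (Thm. 4.3 (1))
is not covered by any declaration of the tree. -/

section AtOne

variable {c : E ≃ₐ[F] E}

/-- `{1 < Re s} ∪ B(1, 1/2) ⊆ {1/2 < Re s}`: on the ball, `|Re s - 1| ≤ ‖s - 1‖ < 1/2`. [folklore] -/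
theorem one_lt_re_union_ball_one_half_subset :
    {s : ℂ | 1 < s.re} ∪ Metric.ball (1 : ℂ) (1 / 2) ⊆ {s : ℂ | 1 / 2 < s.re} := by
  rintro s (hs | hs)
  · simp only [Set.mem_setOf_eq] at hs ⊢
    linarith
  · rw [Metric.mem_ball, dist_eq_norm] at hs
    have h : |s.re - 1| < 1 / 2 := by
      have h' := Complex.abs_re_le_norm (s - 1)
      rw [Complex.sub_re, Complex.one_re] at h'
      exact h'.trans_lt hs
    simp only [Set.mem_setOf_eq]
    linarith [(abs_lt.mp h).1]

namespace AutomorphicRepData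

/-- **A continued simple pole at `s = 1` yields the `s = 1` clause of
`GrbacShahidi2015_partialAsaiL_at_one` with `k = 1`**: the continuation `G` of `(s - 1) L^S(s, Π, As^η)`,
holomorphic on `{1/2 < Re s}` with `G(1) ≠ 0`, is in particular holomorphic on
`{1 < Re s} ∪ B(1, 1/2)`. [folklore] -/
theorem HasAsaiPoleCont.partialAsaiL_at_one {π : AutomorphicRepData (AutomorphyDatum.gl N E hcpt)}
    {η : ℤˣ} (hp : π.HasAsaiPoleCont c η) {S : Set (HeightOneSpectrum (𝓞 F))} {A : SatakeFamily E}
    (hSA : π.IsAsaiDatum c S A) :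
    ∃ σ₀ : ℝ, 1 ≤ σ₀ ∧
      (∀ s : ℂ, σ₀ < s.re →
        Multipliable fun v : {v : HeightOneSpectrum (𝓞 F) // v ∉ S} =>
          ((asaiLocalPolynomial c A η (placeAbove E v.1)).eval ((v.1.residueCard : ℂ) ^ (-s)))⁻¹) ∧
      ∃ (k : ℕ) (δ : ℝ) (G : ℂ → ℂ), k ≤ 1 ∧ 0 < δ ∧
        DifferentiableOn ℂ G ({s : ℂ | 1 < s.re} ∪ Metric.ball 1 δ) ∧
        (∀ s : ℂ, σ₀ < s.re → G s = (s - 1) ^ k * partialAsaiL S c A η s) ∧ G 1 ≠ 0 := by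
  obtain ⟨σ₀, hσ₀, hmul, G, hG, hGL, hG1⟩ := hp hSA
  refine ⟨σ₀, hσ₀, hmul, 1, 1 / 2, G, le_rfl, one_half_pos,
    hG.mono one_lt_re_union_ball_one_half_subset, fun s hs => ?_, hG1⟩
  rw [pow_one, hGL s hs]

/-- **Holomorphy and non-vanishing of the continuation at `s = 1` yields the `s = 1` clause of
`GrbacShahidi2015_partialAsaiL_at_one` with `k = 0`**: the continuation `H` of `L^S(s, Π, As^η)`,
holomorphic on `{1/2 < Re s}` with `H(1) ≠ 0`, is holomorphic on `{1 < Re s} ∪ B(1, 1/2)` and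
`H = (s - 1)^0 L^S` on the half-plane of agreement. [folklore] -/
theorem HasAsaiHolAtOneCont.partialAsaiL_at_one {π : AutomorphicRepData (AutomorphyDatum.gl N E hcpt)}
    {η : ℤˣ} (hh : π.HasAsaiHolAtOneCont c η) {S : Set (HeightOneSpectrum (𝓞 F))} {A : SatakeFamily E}
    (hSA : π.IsAsaiDatum c S A) :
    ∃ σ₀ : ℝ, 1 ≤ σ₀ ∧
      (∀ s : ℂ, σ₀ < s.re →
        Multipliable fun v : {v : HeightOneSpectrum (𝓞 F) // v ∉ S} =>
          ((asaiLocalPolynomial c A η (placeAbove E v.1)).eval ((v.1.residueCard : ℂ) ^ (-s)))⁻¹) ∧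
      ∃ (k : ℕ) (δ : ℝ) (G : ℂ → ℂ), k ≤ 1 ∧ 0 < δ ∧
        DifferentiableOn ℂ G ({s : ℂ | 1 < s.re} ∪ Metric.ball 1 δ) ∧
        (∀ s : ℂ, σ₀ < s.re → G s = (s - 1) ^ k * partialAsaiL S c A η s) ∧ G 1 ≠ 0 := by
  obtain ⟨σ₀, hσ₀, hmul, H, hH, hHL, hH1⟩ := hh hSA
  refine ⟨σ₀, hσ₀, hmul, 0, 1 / 2, H, zero_le_one, one_half_pos,
    hH.mono one_lt_re_union_ball_one_half_subset, fun s hs => ?_, hH1⟩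
  rw [pow_zero, one_mul, hHL s hs]

end AutomorphicRepData

/-- **The Galois-self-dual stratum of Grbac–Shahidi 2015, Thm. 4.3, at `s = 1`, from Mok's dichotomy in
continuation form.**  Printed (Grbac–Shahidi 2015, Thm. 4.3 (2), pp. 186 and 204): for a Galois self-dual
cuspidal `σ` on `GL_n(𝔸_E)`, "(a) `L(s, σ, r_A)` is entire, except for possible simple poles at `s = 0`
and `s = 1`, and nonzero for `Re(s) ≥ 1` and `Re(s) ≤ 0`; (b) exactly one of the `L`-functions
`L(s, σ, r_A)` and `L(s, σ ⊗ δ̂, r_A)` has simple poles at `s = 0` and `s = 1`, while the other is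
holomorphic at those points" — i.e. Mok's dichotomy (Mok, §2.5 and Thm. 2.5.4 (a)), rendered in the
tree as the named fact `Mok2014_partialAsaiL_continuation_pole_dichotomy` (hypothesis `hMok`).
Consequence proved here: under `hMok`, for `[E : F] = 2`, `c ≠ 1`, a conjugate self-dual cuspidal `Π` on
`GL_N(𝔸_E)`, `N ≥ 1` (`IsConjSelfDualAE`), every Asai datum `(S, A)` and EVERY sign `η`, the conclusion
of `GrbacShahidi2015_partialAsaiL_at_one` holds for `(Π, S, A, η)`: `η` is the pole sign `η₀` of the
dichotomy (`k = 1`, `HasAsaiPoleCont.partialAsaiL_at_one`) or `η = -η₀` (`k = 0`,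
`HasAsaiHolAtOneCont.partialAsaiL_at_one`).  What this does NOT give: the fact itself, whose remaining
strata — `Π` unitary cuspidal but not conjugate self-dual (Thm. 4.3 (1): `L(s, σ, r_A)` entire and
non-zero for `Re(s) ≥ 1`), and the unitary-but-not-normalised twists `Π₁ ⊗ |det|^{it₀}` — have no
counterpart declaration in the tree. [cite: GrbacShahidi2015, Thm. 4.3 (2), pp. 186 and 204]
[cite: Mok2014, §2.5 (paragraph before Thm. 2.5.4) and Thm. 2.5.4 (a)] -/
theorem GrbacShahidi2015_partialAsaiL_at_one_of_continuation_dichotomy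
    (hMok : Mok2014_partialAsaiL_continuation_pole_dichotomy) (h2 : Module.finrank F E = 2) (hc : c ≠ 1)
    (hN : 0 < N) (π : CuspidalAutomorphicRepData N E hcpt) (hπ : π.1.IsConjSelfDualAE c)
    {S : Set (HeightOneSpectrum (𝓞 F))} {A : SatakeFamily E} (η : ℤˣ) (hSA : π.1.IsAsaiDatum c S A) :
    ∃ σ₀ : ℝ, 1 ≤ σ₀ ∧
      (∀ s : ℂ, σ₀ < s.re →
        Multipliable fun v : {v : HeightOneSpectrum (𝓞 F) // v ∉ S} =>
          ((asaiLocalPolynomial c A η (placeAbove E v.1)).eval ((v.1.residueCard : ℂ) ^ (-s)))⁻¹) ∧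
      ∃ (k : ℕ) (δ : ℝ) (G : ℂ → ℂ), k ≤ 1 ∧ 0 < δ ∧
        DifferentiableOn ℂ G ({s : ℂ | 1 < s.re} ∪ Metric.ball 1 δ) ∧
        (∀ s : ℂ, σ₀ < s.re → G s = (s - 1) ^ k * partialAsaiL S c A η s) ∧ G 1 ≠ 0 := by
  obtain ⟨η₀, hpole, hhol⟩ := π.exists_hasAsaiPoleCont hMok h2 hc hN hπ
  by_cases hη : η = η₀
  · subst hη
    exact hpole.partialAsaiL_at_one hSA
  · obtain rfl : η = -η₀ := Int.units_ne_iff_eq_neg.mp hη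
    exact hhol.partialAsaiL_at_one hSA

end AtOne

/-! ### Appended 2026-08-16 (lead prover, line `one-transparent-pane` of crux `HostInducedRep`):
Mok's archimedean sign pin in the continuation-form currency

The named fact `Mok2014_archimedean_parity_of_asaiSign` (`AsaiSign.lean`, p114673) renders the Asai
sign of its hypothesis as the RAW partial-Euler-product pole `HasAsaiSign`.  The definition below is
the SAME printed statement with the sign rendered by `HasAsaiSignCont` (the continued partial Asai
`L`-function has its simple pole at `s = 1`, §"vocabulary" above) — the faithful rendering of
"`L(s, Π, As^{(-1)^{N-1}κ})` has a pole at `s = 1`"; as a hypothesis it also carries the standard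
analytic package (multipliability on a right half-plane, holomorphic continuation to `{1/2 < Re s}`
away from the pole, non-vanishing at `1`), all of which hold for cuspidal `Π`, so the rendering is
weaker than print exactly where a hypothesis may be.  It lets the consumers of the sign pin work in
one currency with `Mok2014_partialAsaiL_continuation_pole_dichotomy`, with no Ramanujan-strength
hypothesis on raw products.
-/

/-- **Mok 2014 (Thm. 2.4.10, Lemma 2.2.1, Remark 2.2.2, Cor. 2.5.5 in coset form), continuation-form
currency.** Printed ingredients: Thm. 2.4.10 — for `Π` conjugate self-dual cuspidal on `GL_N(𝔸_E)`
with Asai sign `κ` and a place `v` of `F` not split in `E`, the localization `φ^N_v` factors through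
`ξ_{χ_κ}`; Lemma 2.2.1 — such a parameter is conjugate self-dual of parity `(-1)^{N-1} κ`; Remark
2.2.2 — for a multiplicity-free parameter the parity is unique; (2.2.6) and Cor. 2.5.5: "Suppose that
`Π` is a conjugate self-dual (unitary) cuspidal automorphic representation on `GL_N(𝔸_E)`. Suppose
there exists a place `v` of `F` such that `F_v = ℝ`, `E_v = ℂ`, and that the `L`-parameter
corresponding to `Π_v` is given by (2.5.12) [`a_i ∈ (N+1)/2 + ℤ`, distinct]. Then
`L(s, Π, Asai^{(-1)^{N-1}})` has a pole at `s = 1`."  Coset form: if the exponents `a_i` at a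
`c`-fixed complex place are distinct and lie in one real coset `r + ℤ`, then
`a_i ∈ (N-1)/2 + (1-κ)/4 + ℤ`.  Rendering: exactly `Mok2014_archimedean_parity_of_asaiSign` with the
hypothesis `HasAsaiSign c κ` replaced by `HasAsaiSignCont c κ` (the continued partial Asai
`L`-function `L^S(s, Π, As^{(-1)^{N-1}κ})` has its simple pole at `s = 1`, for every unramified Asai
datum).  Named fact (D-0014), not proved here; conditional, like all of Mok's results, on the
stabilisation of the twisted trace formula (barrier file `TwistedEndoscopySelfDual`).
-- TODO(general form): Mok Thm. 2.4.10 + Thm. 2.5.2 at every place, once local Langlands parameters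
-- of `GL_N` over local fields are in the tree.
[cite: Mok2014, Thm. 2.4.10, Lemma 2.2.1, Remark 2.2.2 and Cor. 2.5.5]
[cite: GanGrossPrasad2012, Lemma 3.4 and Thm. 8.1] -/
def Mok2014_archimedean_parity_of_asaiSignCont : Prop :=
  ∀ (F E : Type) [Field F] [NumberField F] [Field E] [NumberField E] [Algebra F E]
    (c : E ≃ₐ[F] E), Module.finrank F E = 2 → c ≠ 1 →
    ∀ (N : ℕ) (hcpt : isCompact_glFiniteIntegralLevel N E) (P : CuspidalAutomorphicRepData N E hcpt)
      (κ : ℤˣ) (χ : (E →+* ℂ) → Multiset ℂ) (σ : E →+* ℂ) (r : ℝ),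
      0 < N → P.1.IsConjSelfDualAE c → P.1.HasAsaiSignCont c κ → P.1.HasArchParameter χ →
      NumberField.ComplexEmbedding.IsConj σ c → (χ σ).Nodup →
      (∀ a ∈ χ σ, ∃ m : ℤ, a = (m : ℂ) + (r : ℂ)) →
      ∀ a ∈ χ σ, ∃ m : ℤ, a = (m : ℂ) + ((N : ℂ) - 1) / 2 + (1 - ((κ : ℤ) : ℂ)) / 4

end Literature.NumberTheory.Automorphic

end
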